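import Summits.SmoothPoincare4.SmoothPoincare4.Theses.EntropyRung
import Summits.SmoothPoincare4.SmoothPoincare4.Theorems.SubcylindricalExistence.Negative.Logic
import Summits.SmoothPoincare4.SmoothPoincare4.Theorems.EntropyRungSubcylindricalExistenceConformalGluing
import HarnessLib

/-!
# The transfer stub of line `green-blowup-conformal-entropy` is SPC4-hard given the rung
# (crux `EntropyRung.SubcylindricalExistence`, stmt-SmoothPoincare4-10871; lead c2; negative side)

The line `green-blowup-conformal-entropy` reduces the crux ENT to ONE statement, its transfer stub
A‴ `stub_blowupExistence` (every closed smooth homotopy 4-sphere carries Green data in Schoen's flat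
gauge whose blow-up clears `ν_cyl + δ`): `A‴ → ENT` is the landed
`Summit.SmoothPoincare4.SmoothPoincare4.Theorems.subcylindricalExistence_of_blowupExistence`.
Composing with the route's deciding theorem `closes : SubcylindricalRecognition → ENT → SPC4` gives
the conditional results recorded here: given the rung, A‴ proves SPC4 (`spc4_of_blowupExistence`), and an
exotic 4-sphere refutes A‴ (`not_blowupExistence_of_not_spc4`, the registered export). So A‴ carries the
full difficulty of the summit along this route: it is crux-sized, to be promoted, not a lemma to be found.
Pure logic over landed theorems; no definitions, no named facts, nothing asserted unconditionally.
-/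

noncomputable section

-- the namespace of the crux's negative side repeats a component of the route namespace
set_option linter.dupNamespace false

open scoped Manifold ContDiff Topology RealInnerProductSpace ContinuousMap
open Set Filter MeasureTheory
open Literature.Geometry.Lorentzian
open Summit.SmoothPoincare4.SmoothPoincare4.Theses.EntropyRung

namespace Summit.SmoothPoincare4.Cruxes.SubcylindricalExistence.Negative

/-- **A‴ ⇒ SPC4 given the rung**: blow-up existence in the flat gauge (the transfer stub of line
`green-blowup-conformal-entropy`) implies the smooth 4-dimensional Poincaré conjecture as soon as
`SubcylindricalRecognition` holds — `closes` after the landed reduction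
`subcylindricalExistence_of_blowupExistence`. [folklore] -/
theorem spc4_of_blowupExistence (hRung : SubcylindricalRecognition)
    (hA : ∀ (M : Type) [TopologicalSpace M] [T2Space M] [SecondCountableTopology M]
      [ChartedSpace (EuclideanSpace ℝ (Fin 4)) M] [IsManifold (𝓡 4) ∞ M] [CompactSpace M]
      [T3Space M] [MeasurableSpace M] [BorelSpace M],
      M ≃ₕ Metric.sphere (0 : EuclideanSpace ℝ (Fin 5)) 1 →
      ∃ g : PseudoRiemannianMetric (𝓡 4) ∞ (EuclideanSpace ℝ (Fin 4)) (TangentSpace (𝓡 4) : M → Type _),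
      ∃ _ : g.HasLeviCivita, ∃ hg : g.IsRiemannian, ∃ p : M, ∃ G : M → ℝ, ∃ a r : ℝ,
        (ContMDiffOn (𝓡 4) 𝓘(ℝ, ℝ) ∞ G {p}ᶜ ∧ (∀ x, x ≠ p → 0 < G x) ∧
          (∀ x, x ≠ p → g.scalarCurvature x * G x - 6 * g.dalembertian G x = 0) ∧
          Tendsto G (𝓝[≠] p) atTop) ∧
        (∀ x, 0 ≤ g.scalarCurvature x) ∧
        (∀ x, g.scalarCurvature x = 0 → x ∈ (extChartAt (𝓡 4) p).source ∧
          extChartAt (𝓡 4) p x ∈ Metric.closedBall (extChartAt (𝓡 4) p p) r) ∧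
        0 < a ∧ 0 < r ∧
        (Metric.closedBall (extChartAt (𝓡 4) p p) r ⊆ (extChartAt (𝓡 4) p).target ∧
          ∀ y ∈ Metric.closedBall (extChartAt (𝓡 4) p p) r, ∀ X W : EuclideanSpace ℝ (Fin 4),
            g.val ((extChartAt (𝓡 4) p).symm y)
              (mfderiv 𝓘(ℝ, EuclideanSpace ℝ (Fin 4)) (𝓡 4) (extChartAt (𝓡 4) p).symm y X)
              (mfderiv 𝓘(ℝ, EuclideanSpace ℝ (Fin 4)) (𝓡 4) (extChartAt (𝓡 4) p).symm y W) = ⟪X, W⟫) ∧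
        (∀ y ∈ Metric.closedBall (extChartAt (𝓡 4) p p) r, y ≠ extChartAt (𝓡 4) p p →
          G ((extChartAt (𝓡 4) p).symm y) = a / ‖y - extChartAt (𝓡 4) p p‖ ^ 2) ∧
        ∃ δ : ℝ, 0 < δ ∧ ∀ τ : ℝ, 0 < τ → ∀ w : M → ℝ, ContMDiff (𝓡 4) 𝓘(ℝ, ℝ) ∞ w →
          w =ᶠ[𝓝 p] 0 →
          ∫ x, (4 * Real.pi * τ) ^ (-(4 : ℝ) / 2) * (w x) ^ 2 * (G x) ^ 4
              ∂(riemannianMeasure (g.toContMDiffRiemannianMetric hg)) = 1 →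
            Real.log 2 + Real.log Real.pi / 2 - 3 / 2 + δ ≤
              ∫ x, (4 * τ * ((G x)⁻¹ ^ 2 * g.gradSq w x) - (w x) ^ 2 * Real.log ((w x) ^ 2)
                  - 4 * (w x) ^ 2) * ((4 * Real.pi * τ) ^ (-(4 : ℝ) / 2) * (G x) ^ 4)
                ∂(riemannianMeasure (g.toContMDiffRiemannianMetric hg))) :
    _root_.SmoothPoincare4 :=
  closes hRung
    (_root_.Summit.SmoothPoincare4.SmoothPoincare4.Theorems.subcylindricalExistence_of_blowupExistence hA)

/-- **¬SPC4 ⇒ ¬A‴ given the rung** (registered export `not_blowupExistence_of_not_spc4` of crux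
stmt-SmoothPoincare4-10871): an exotic 4-sphere kills the transfer stub of line
`green-blowup-conformal-entropy` once `SubcylindricalRecognition` holds. [folklore] -/
theorem not_blowupExistence_of_not_spc4 :
    Summit.SmoothPoincare4.SmoothPoincare4.Theses.EntropyRung.SubcylindricalRecognition →
    ¬ _root_.SmoothPoincare4 →
    ¬ (∀ (M : Type) [TopologicalSpace M] [T2Space M] [SecondCountableTopology M]
      [ChartedSpace (EuclideanSpace ℝ (Fin 4)) M] [IsManifold (𝓡 4) ∞ M] [CompactSpace M]
      [T3Space M] [MeasurableSpace M] [BorelSpace M],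
      M ≃ₕ Metric.sphere (0 : EuclideanSpace ℝ (Fin 5)) 1 →
      ∃ g : PseudoRiemannianMetric (𝓡 4) ∞ (EuclideanSpace ℝ (Fin 4)) (TangentSpace (𝓡 4) : M → Type _),
      ∃ _ : g.HasLeviCivita, ∃ hg : g.IsRiemannian, ∃ p : M, ∃ G : M → ℝ, ∃ a r : ℝ,
        (ContMDiffOn (𝓡 4) 𝓘(ℝ, ℝ) ∞ G {p}ᶜ ∧ (∀ x, x ≠ p → 0 < G x) ∧
          (∀ x, x ≠ p → g.scalarCurvature x * G x - 6 * g.dalembertian G x = 0) ∧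
          Tendsto G (𝓝[≠] p) atTop) ∧
        (∀ x, 0 ≤ g.scalarCurvature x) ∧
        (∀ x, g.scalarCurvature x = 0 → x ∈ (extChartAt (𝓡 4) p).source ∧
          extChartAt (𝓡 4) p x ∈ Metric.closedBall (extChartAt (𝓡 4) p p) r) ∧
        0 < a ∧ 0 < r ∧
        (Metric.closedBall (extChartAt (𝓡 4) p p) r ⊆ (extChartAt (𝓡 4) p).target ∧
          ∀ y ∈ Metric.closedBall (extChartAt (𝓡 4) p p) r, ∀ X W : EuclideanSpace ℝ (Fin 4),
            g.val ((extChartAt (𝓡 4) p).symm y)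
              (mfderiv 𝓘(ℝ, EuclideanSpace ℝ (Fin 4)) (𝓡 4) (extChartAt (𝓡 4) p).symm y X)
              (mfderiv 𝓘(ℝ, EuclideanSpace ℝ (Fin 4)) (𝓡 4) (extChartAt (𝓡 4) p).symm y W) = ⟪X, W⟫) ∧
        (∀ y ∈ Metric.closedBall (extChartAt (𝓡 4) p p) r, y ≠ extChartAt (𝓡 4) p p →
          G ((extChartAt (𝓡 4) p).symm y) = a / ‖y - extChartAt (𝓡 4) p p‖ ^ 2) ∧
        ∃ δ : ℝ, 0 < δ ∧ ∀ τ : ℝ, 0 < τ → ∀ w : M → ℝ, ContMDiff (𝓡 4) 𝓘(ℝ, ℝ) ∞ w →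
          w =ᶠ[𝓝 p] 0 →
          ∫ x, (4 * Real.pi * τ) ^ (-(4 : ℝ) / 2) * (w x) ^ 2 * (G x) ^ 4
              ∂(riemannianMeasure (g.toContMDiffRiemannianMetric hg)) = 1 →
            Real.log 2 + Real.log Real.pi / 2 - 3 / 2 + δ ≤
              ∫ x, (4 * τ * ((G x)⁻¹ ^ 2 * g.gradSq w x) - (w x) ^ 2 * Real.log ((w x) ^ 2)
                  - 4 * (w x) ^ 2) * ((4 * Real.pi * τ) ^ (-(4 : ℝ) / 2) * (G x) ^ 4)
                ∂(riemannianMeasure (g.toContMDiffRiemannianMetric hg))) :=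
  fun hRung h hA ↦ h (spc4_of_blowupExistence hRung hA)

end Summit.SmoothPoincare4.Cruxes.SubcylindricalExistence.Negative

end
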